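import Mathlib
import Summits.Ventures.HodgeRepro2.Hypothesis
import Summits.Ventures.HodgeRepro2.BallActionU21
import Summits.Ventures.HodgeRepro2.Level
import Summits.Ventures.HodgeRepro2.LevelNeat
import Summits.Ventures.HodgeRepro2.DefiniteUnitaryBounded
import Summits.Ventures.HodgeRepro2.IntegralUnitaryDiscrete
import Summits.Ventures.HodgeRepro2.LevelDiscrete
import Summits.Ventures.HodgeRepro2.BallStabilizerBounded
import Summits.Ventures.HodgeRepro2.BallFreeAction
import Summits.Ventures.HodgeRepro2.BallMulAction

/-!
# `Γ'\𝔹² → Γ\𝔹²` for `Γ' ≤ Γ` of finite index: a finite-to-one surjection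

DR15 (Doc. Math. 20 (2015), §1–§3) and Shimura (J. Math. Soc. Japan 31 (1979), §4) compare the
surfaces `Y_{Γ'} = Γ'\𝔹²` and `Y_Γ` for `Γ' ≤ Γ` of finite index through the natural finite map
`Y_{Γ'} → Y_Γ` (of degree `[Γ : Γ']` when both are neat).  This file kernel-checks the
set-theoretic statement for the frame action of `BallMulAction.lean`:

* `ballQuotientMap` — the natural map `S'\𝔹² → S\𝔹²` for `S' ≤ S`, and
  `ballQuotientMap_surjective`;
* `fiberOfRightCoset` — the fibre over the class of `z` is the image of the right coset space
  `S'\S`, `γ ↦ [γ · z]`;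
* `finite_fiber_ballQuotientMap` / `card_fiber_ballQuotientMap_le` — **for `S'` of finite index in
  `S` every fibre is finite, of cardinality at most `[S : S']`** — in particular for the
  finite-index subgroups `Γ ≤ Γ_1` of `NonVanishingInput` (`IsFiniteIndexSubgroupOf`) and for
  `Γ_N ≤ Γ_1` (`isFiniteIndexSubgroupOf_shimuraLevel_one`, LevelFiniteIndex p394950).
-/

open Matrix

namespace Summit.Ventures.HodgeRepro2.ShimuraData

section CMField

variable {K : Type*} [Field K] [NumberField K] [NumberField.IsCMField K]

/-- A subgroup of a subgroup of `U(H)` is a subgroup of `U(H)`. -/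
theorem subset_unitaryGroup_of_le {H : Matrix (Fin 3) (Fin 3) K} {S' S : Subgroup (GL (Fin 3) K)}
    (hS'S : S' ≤ S) (hS : (S : Set (GL (Fin 3) K)) ⊆ unitaryGroup K H) :
    (S' : Set (GL (Fin 3) K)) ⊆ unitaryGroup K H :=
  fun _ hγ => hS (hS'S hγ)

/-- **The natural map `S'\𝔹² → S\𝔹²`** for `S' ≤ S`. -/
noncomputable def ballQuotientMap {τ₁ : K →+* ℂ} {H : Matrix (Fin 3) (Fin 3) K}
    {Q : Matrix (Fin 3) (Fin 3) ℂ} (hQ : IsFrame K τ₁ H Q) {S' S : Subgroup (GL (Fin 3) K)}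
    (hS'S : S' ≤ S) (hS : (S : Set (GL (Fin 3) K)) ⊆ unitaryGroup K H) :
    ballQuotient hQ S' (subset_unitaryGroup_of_le hS'S hS) → ballQuotient hQ S hS :=
  letI := frameAction hQ S' (subset_unitaryGroup_of_le hS'S hS)
  letI := frameAction hQ S hS
  Quotient.map' id fun z z' h => by
    rw [MulAction.orbitRel_apply, MulAction.mem_orbit_iff] at h ⊢
    obtain ⟨γ, hγ⟩ := h
    exact ⟨⟨γ, hS'S γ.2⟩, by rw [← hγ]; rfl⟩

/-- `ballQuotientMap` on classes. -/
theorem ballQuotientMap_mk {τ₁ : K →+* ℂ} {H : Matrix (Fin 3) (Fin 3) K}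
    {Q : Matrix (Fin 3) (Fin 3) ℂ} (hQ : IsFrame K τ₁ H Q) {S' S : Subgroup (GL (Fin 3) K)}
    (hS'S : S' ≤ S) (hS : (S : Set (GL (Fin 3) K)) ⊆ unitaryGroup K H) (z : ball₂) :
    ballQuotientMap hQ hS'S hS (ballQuotient.mk hQ S' (subset_unitaryGroup_of_le hS'S hS) z) =
      ballQuotient.mk hQ S hS z :=
  rfl

/-- `ballQuotient.mk` is surjective. -/
theorem ballQuotient_mk_surjective {τ₁ : K →+* ℂ} {H : Matrix (Fin 3) (Fin 3) K}
    {Q : Matrix (Fin 3) (Fin 3) ℂ} (hQ : IsFrame K τ₁ H Q) (S : Subgroup (GL (Fin 3) K))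
    (hS : (S : Set (GL (Fin 3) K)) ⊆ unitaryGroup K H) :
    Function.Surjective (ballQuotient.mk hQ S hS) :=
  fun q => Quotient.inductionOn' q fun z => ⟨z, rfl⟩

/-- `ballQuotientMap` is surjective. -/
theorem ballQuotientMap_surjective {τ₁ : K →+* ℂ} {H : Matrix (Fin 3) (Fin 3) K}
    {Q : Matrix (Fin 3) (Fin 3) ℂ} (hQ : IsFrame K τ₁ H Q) {S' S : Subgroup (GL (Fin 3) K)}
    (hS'S : S' ≤ S) (hS : (S : Set (GL (Fin 3) K)) ⊆ unitaryGroup K H) :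
    Function.Surjective (ballQuotientMap hQ hS'S hS) := by
  intro q
  obtain ⟨z, rfl⟩ := ballQuotient_mk_surjective hQ S hS q
  exact ⟨ballQuotient.mk hQ S' (subset_unitaryGroup_of_le hS'S hS) z, rfl⟩

/-- Two points have the same class in `S\𝔹²` iff they differ by an element of `S` (action form). -/
theorem ballQuotient_mk_eq_mk_iff' {τ₁ : K →+* ℂ} {H : Matrix (Fin 3) (Fin 3) K}
    {Q : Matrix (Fin 3) (Fin 3) ℂ} (hQ : IsFrame K τ₁ H Q) (S : Subgroup (GL (Fin 3) K))
    (hS : (S : Set (GL (Fin 3) K)) ⊆ unitaryGroup K H) (z z' : ball₂) :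
    letI := frameAction hQ S hS
    (ballQuotient.mk hQ S hS z = ballQuotient.mk hQ S hS z' ↔ ∃ γ : S, γ • z' = z) := by
  letI := frameAction hQ S hS
  rw [ballQuotient_mk_eq_mk_iff]
  constructor
  · rintro ⟨γ, hγ⟩; exact ⟨γ, Subtype.ext hγ⟩
  · rintro ⟨γ, hγ⟩; exact ⟨γ, congrArg Subtype.val hγ⟩

/-- `[γ · z]` lies in the fibre over `[z]`. -/
theorem ballQuotientMap_mk_smul {τ₁ : K →+* ℂ} {H : Matrix (Fin 3) (Fin 3) K}
    {Q : Matrix (Fin 3) (Fin 3) ℂ} (hQ : IsFrame K τ₁ H Q) {S' S : Subgroup (GL (Fin 3) K)}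
    (hS'S : S' ≤ S) (hS : (S : Set (GL (Fin 3) K)) ⊆ unitaryGroup K H) (γ : S) (z : ball₂) :
    letI := frameAction hQ S hS
    ballQuotientMap hQ hS'S hS
      (ballQuotient.mk hQ S' (subset_unitaryGroup_of_le hS'S hS) (γ • z)) =
        ballQuotient.mk hQ S hS z := by
  letI := frameAction hQ S hS
  rw [ballQuotientMap_mk, ballQuotient_mk_eq_mk_iff']
  exact ⟨γ, rfl⟩

/-- Right-coset-related elements of `S` give the same class in `S'\𝔹²`. -/
theorem ballQuotient_mk_smul_eq_of_rightRel {τ₁ : K →+* ℂ} {H : Matrix (Fin 3) (Fin 3) K}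
    {Q : Matrix (Fin 3) (Fin 3) ℂ} (hQ : IsFrame K τ₁ H Q) {S' S : Subgroup (GL (Fin 3) K)}
    (hS'S : S' ≤ S) (hS : (S : Set (GL (Fin 3) K)) ⊆ unitaryGroup K H) (z : ball₂) {x y : S}
    (hxy : (QuotientGroup.rightRel (S'.subgroupOf S)) x y) :
    letI := frameAction hQ S hS
    ballQuotient.mk hQ S' (subset_unitaryGroup_of_le hS'S hS) (x • z) =
      ballQuotient.mk hQ S' (subset_unitaryGroup_of_le hS'S hS) (y • z) := by
  letI := frameAction hQ S hS
  letI := frameAction hQ S' (subset_unitaryGroup_of_le hS'S hS)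
  rw [ballQuotient_mk_eq_mk_iff']
  have hmem : ((y * x⁻¹ : S) : GL (Fin 3) K) ∈ S' :=
    Subgroup.mem_subgroupOf.mp (QuotientGroup.rightRel_apply.mp hxy)
  have hmem' : ((x * y⁻¹ : S) : GL (Fin 3) K) ∈ S' := by
    have := S'.inv_mem hmem
    rwa [← Subgroup.coe_inv, _root_.mul_inv_rev, inv_inv] at this
  refine ⟨⟨(x * y⁻¹ : S), hmem'⟩, ?_⟩
  have e : ((⟨(x * y⁻¹ : S), hmem'⟩ : S') • (y • z) : ball₂) = (x * y⁻¹ : S) • (y • z) := rfl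
  rw [e, mul_smul, inv_smul_smul]

/-- The fibre of `ballQuotientMap` over the class of `z`, parametrised by the right coset space
`S'\S`: `S'γ ↦ [γ · z]`. -/
noncomputable def fiberOfRightCoset {τ₁ : K →+* ℂ} {H : Matrix (Fin 3) (Fin 3) K}
    {Q : Matrix (Fin 3) (Fin 3) ℂ} (hQ : IsFrame K τ₁ H Q) {S' S : Subgroup (GL (Fin 3) K)}
    (hS'S : S' ≤ S) (hS : (S : Set (GL (Fin 3) K)) ⊆ unitaryGroup K H) (z : ball₂) :
    Quotient (QuotientGroup.rightRel (S'.subgroupOf S)) →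
      {q' // ballQuotientMap hQ hS'S hS q' = ballQuotient.mk hQ S hS z} :=
  letI := frameAction hQ S hS
  Quotient.lift
    (fun γ : S => ⟨ballQuotient.mk hQ S' (subset_unitaryGroup_of_le hS'S hS) (γ • z),
      ballQuotientMap_mk_smul hQ hS'S hS γ z⟩)
    (fun _ _ hxy => Subtype.ext (ballQuotient_mk_smul_eq_of_rightRel hQ hS'S hS z hxy))

/-- `fiberOfRightCoset` is surjective onto the fibre. -/
theorem fiberOfRightCoset_surjective {τ₁ : K →+* ℂ} {H : Matrix (Fin 3) (Fin 3) K}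
    {Q : Matrix (Fin 3) (Fin 3) ℂ} (hQ : IsFrame K τ₁ H Q) {S' S : Subgroup (GL (Fin 3) K)}
    (hS'S : S' ≤ S) (hS : (S : Set (GL (Fin 3) K)) ⊆ unitaryGroup K H) (z : ball₂) :
    Function.Surjective (fiberOfRightCoset hQ hS'S hS z) := by
  letI := frameAction hQ S hS
  rintro ⟨q', hq'⟩
  obtain ⟨z', rfl⟩ := ballQuotient_mk_surjective hQ S' (subset_unitaryGroup_of_le hS'S hS) q'
  rw [ballQuotientMap_mk, ballQuotient_mk_eq_mk_iff'] at hq'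
  obtain ⟨γ, hγ⟩ := hq'
  refine ⟨Quotient.mk'' γ, Subtype.ext ?_⟩
  show ballQuotient.mk hQ S' (subset_unitaryGroup_of_le hS'S hS) (γ • z) =
    ballQuotient.mk hQ S' (subset_unitaryGroup_of_le hS'S hS) z'
  rw [hγ]

/-- **Finite fibres.**  For `S'` of finite index in `S`, every fibre of `S'\𝔹² → S\𝔹²` is finite. -/
theorem finite_fiber_ballQuotientMap {τ₁ : K →+* ℂ} {H : Matrix (Fin 3) (Fin 3) K}
    {Q : Matrix (Fin 3) (Fin 3) ℂ} (hQ : IsFrame K τ₁ H Q) {S' S : Subgroup (GL (Fin 3) K)}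
    (hS'S : S' ≤ S) (hS : (S : Set (GL (Fin 3) K)) ⊆ unitaryGroup K H)
    [hfi : (S'.subgroupOf S).FiniteIndex] (q : ballQuotient hQ S hS) :
    Finite {q' // ballQuotientMap hQ hS'S hS q' = q} := by
  obtain ⟨z, rfl⟩ := ballQuotient_mk_surjective hQ S hS q
  haveI : Finite (S ⧸ S'.subgroupOf S) := inferInstance
  haveI : Finite (Quotient (QuotientGroup.rightRel (S'.subgroupOf S))) :=
    Finite.of_equiv _ (QuotientGroup.quotientRightRelEquivQuotientLeftRel (S'.subgroupOf S)).symm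
  exact Finite.of_surjective _ (fiberOfRightCoset_surjective hQ hS'S hS z)

/-- **Degree bound.**  For `S'` of finite index in `S`, every fibre of `S'\𝔹² → S\𝔹²` has at most
`[S : S']` elements. -/
theorem card_fiber_ballQuotientMap_le {τ₁ : K →+* ℂ} {H : Matrix (Fin 3) (Fin 3) K}
    {Q : Matrix (Fin 3) (Fin 3) ℂ} (hQ : IsFrame K τ₁ H Q) {S' S : Subgroup (GL (Fin 3) K)}
    (hS'S : S' ≤ S) (hS : (S : Set (GL (Fin 3) K)) ⊆ unitaryGroup K H)
    [hfi : (S'.subgroupOf S).FiniteIndex] (q : ballQuotient hQ S hS) :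
    Nat.card {q' // ballQuotientMap hQ hS'S hS q' = q} ≤ (S'.subgroupOf S).index := by
  obtain ⟨z, rfl⟩ := ballQuotient_mk_surjective hQ S hS q
  haveI : Finite (S ⧸ S'.subgroupOf S) := inferInstance
  haveI : Finite (Quotient (QuotientGroup.rightRel (S'.subgroupOf S))) :=
    Finite.of_equiv _ (QuotientGroup.quotientRightRelEquivQuotientLeftRel (S'.subgroupOf S)).symm
  calc Nat.card {q' // ballQuotientMap hQ hS'S hS q' = ballQuotient.mk hQ S hS z}
      ≤ Nat.card (Quotient (QuotientGroup.rightRel (S'.subgroupOf S))) :=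
        Nat.card_le_card_of_surjective _ (fiberOfRightCoset_surjective hQ hS'S hS z)
    _ = Nat.card (S ⧸ S'.subgroupOf S) :=
        Nat.card_congr (QuotientGroup.quotientRightRelEquivQuotientLeftRel (S'.subgroupOf S))
    _ = (S'.subgroupOf S).index := (Subgroup.index_eq_card _).symm

end CMField

end Summit.Ventures.HodgeRepro2.ShimuraData
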